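import Mathlib.Tactic
import HarnessLib

/-!
# Kozma–Nitzan's Question 8 at three relays — the (Q-A) reduction chain and the k₁ = 1 visibility theorems (gen 29)

Support file (`--supports stmt-CriticalPhenomena-4575`, closed crux; independent mathematics on Kozma–Nitzan's Question 8,
arXiv:2401.12397 §5.5 p. 36), prover `prim-ineq-gen-6` (gen 29).  No definitions, no named facts, no sorries; standard axioms.
Memo `run/shared/lean/prim/prim-ineq-gen-6/FINDING-G29.md` / `PROOF-QA-K1-G29.md`.

Setting: a path-end block with out-defect `c > 0`; emissions `η_k = ρ_kU_k/(a_kγ_kp_k)`, `g_k = γ_kη_k`, `θ_k = a_k/γ_k`;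
SSC(U) (gen 27) makes `g_k > 0` exactly for `k < k₁`.  The corner condition (Q-A)_d behind UNI-A(U;y) (THEOREM R, gen 28)
reads `Pg_d > 0 ⟹ Qa_d ≥ −c` (`Pg = Σg`, `Qa = Σθg`).  The kernels below are the algebraic cores of:
* `qa_of_ck_core` — (Q-A)_d ⟸ CK at the θ-argmax (`Qa ≥ Q₊ − θ*N`, `N ≤ P₊`, `(θ* − θ_min)P₊... `), here in the one-positive-depth
  form `Q₊ = θ₀P₊`;
* `ck_of_lemmaJ_core` — for `k₁ = 1`: CK ⟸ LEMMA J `ρ₀(θ_k−θ₀)⁺ ≤ p₀/Φ` (uses `|Ũ₀| ≤ v₁γ₀a₀N′`, `D ≥ s₁a₀v₁`, `u₀ ≥ s₁γ₀u₁`,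
  `c·Φ = D·ϖ`, `ϖ = Φu₀ − m(1−Φ)` and the side condition `a₀m ≤ γ₀(Φ+m)`);
* `kill_or_visibility_core` — LEMMA KV (every depth): `Ũ·m″ ≥ γu″v″[(Φ+m)v″ − a²ΦS·m″]` from `L̃ ≥ 0` and LEMMA R~
  `R̃m″ ≥ γ(Φ+m)u″v″`;
* `nx_class_bound`, `pos_of_weighted_sum_pos` — THEOREM NX′ at `k = 1`: positivity at depth 0 in the form (VIS+)
  `Σ_l r_l f_l > 0` with `f_l ≤ p_l(1−α_l)((1+λ)C₁ − 1)` forces `(1+λ)C₁ > 1`, i.e. `(1−C₁)/C₁ < λ = a₀Φs₁/(Φ+m)` (sharp);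
* `lemmaJ_of_nx_bound` — NX′ ⟹ LEMMA J: `(1−s₁)a₀²Φ² ≤ γ₀(Φ+m)p₀` given `1−γ₀ ≤ a₀²s₁/3` (the positive-region corollary of gen 27).
[cite: KozmaNitzan2024, Question 8 (§5.5 p. 36)]
-/

namespace Summit.CriticalPhenomena.PercolationContinuityZ3.Theorems

namespace PocketCert

/-- **(Q-A) from CK, one positive depth.**  If `Qa ≥ Q₊ − θ*·N` (negatives weighted by at most the θ-maximum),
`Q₊ = θ₀·P₊`, the kill mass satisfies `N ≤ P₊` (the hypothesis `Pg_d > 0`), `θ* ≥ 0`, and CK `(θ* − θ₀)·P₊ ≤ c`, then `Qa ≥ −c`.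
[cite: KozmaNitzan2024, Question 8 (§5.5 p. 36)] -/
theorem qa_of_ck_core (Qa P N θs θ0 c : ℝ) (hQa : θ0 * P - θs * N ≤ Qa) (hN : N ≤ P) (hθs : 0 ≤ θs)
    (hCK : (θs - θ0) * P ≤ c) : -c ≤ Qa := by
  nlinarith [mul_le_mul_of_nonneg_left hN hθs]

/-- **(Q-A) from CK, general positive region.**  With `Q₊ ≥ θmin·P₊` (all positive depths have `θ ≥ θmin`), `Qa ≥ Q₊ − θ*N`,
`N ≤ P₊`, `θ* ≥ 0` and `(θ* − θmin)·P₊ ≤ c`: `Qa ≥ −c`.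
[cite: KozmaNitzan2024, Question 8 (§5.5 p. 36)] -/
theorem qa_of_ck_core' (Qa Qp P N θs θmin c : ℝ) (hQa : Qp - θs * N ≤ Qa) (hQp : θmin * P ≤ Qp) (hN : N ≤ P)
    (hθs : 0 ≤ θs) (hCK : (θs - θmin) * P ≤ c) : -c ≤ Qa := by
  nlinarith [mul_le_mul_of_nonneg_left hN hθs]

/-- **CK from LEMMA J (k₁ = 1), algebraic core.**  Data of depth 0 of a path-end block: `0 < s₁ < 1`, `0 < Φ ≤ 1`, `p₀, a₀, γ₀ > 0`,
`v₁, m ≥ 0`; `N′ = a₀Φs₁u₁ − (Φ+m)(1−Φ) ≥ 0` (positivity margin); `|Ũ₀| ≤ v₁γ₀a₀N′` (from `L̃₀ ≥ 0`, `R₀ ≥ a₀K₄`);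
`g₀·(a₀p₀) = (1−s₁)|Ũ₀|`; `c·Φ = D·ϖ` with `D ≥ s₁a₀v₁`, `ϖ = Φu₀ − m(1−Φ) ≥ 0`, `u₀ ≥ s₁γ₀u₁`; side condition `a₀m ≤ γ₀(Φ+m)`;
LEMMA J in the form `(1−s₁)·ex·Φ ≤ s₁·p₀` for the excess `ex = (θ_k − θ₀)⁺ ≥ 0`.  Conclusion CK: `ex·g₀ ≤ c`.
[cite: KozmaNitzan2024, Question 8 (§5.5 p. 36)] -/
theorem ck_of_lemmaJ_core (s₁ Φ p₀ a₀ γ₀ u₀ u₁ v₁ m D ϖ c g₀ Ut N' ex : ℝ)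
    (hs₁ : 0 < s₁) (hs₁' : s₁ < 1) (hΦ : 0 < Φ) (hΦ1 : Φ ≤ 1) (hp₀ : 0 < p₀) (ha₀ : 0 < a₀) (hγ₀ : 0 < γ₀)
    (hv₁ : 0 ≤ v₁) (hm : 0 ≤ m) (hex : 0 ≤ ex)
    (hN' : N' = a₀ * Φ * s₁ * u₁ - (Φ + m) * (1 - Φ)) (hN'0 : 0 ≤ N')
    (hκ : a₀ * m ≤ γ₀ * (Φ + m)) (hu₀ : s₁ * γ₀ * u₁ ≤ u₀) (hϖ : ϖ = Φ * u₀ - m * (1 - Φ)) (hϖ0 : 0 ≤ ϖ)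
    (hD : s₁ * a₀ * v₁ ≤ D) (hc : c * Φ = D * ϖ) (hUt : Ut ≤ v₁ * γ₀ * a₀ * N') (hg₀ : g₀ * (a₀ * p₀) = (1 - s₁) * Ut)
    (hJ : (1 - s₁) * ex * Φ ≤ s₁ * p₀) : ex * g₀ ≤ c := by
  have hΦm : 0 < Φ + m := by linarith
  have e2 : (Φ + m) * (1 - Φ) = a₀ * Φ * s₁ * u₁ - N' := by rw [hN']; ring
  have hX : N' ≤ a₀ * Φ * s₁ * u₁ := by
    have : 0 ≤ (Φ + m) * (1 - Φ) := mul_nonneg (le_of_lt hΦm) (by linarith)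
    linarith
  have hκ' : 0 ≤ γ₀ * (Φ + m) - a₀ * m := by linarith
  -- Step A: γ₀ N' ≤ a₀ ϖ
  have t1 : a₀ * ϖ * (Φ + m) = a₀ * Φ * u₀ * (Φ + m) - a₀ * m * (a₀ * Φ * s₁ * u₁ - N') := by
    rw [hϖ, ← e2]; ring
  have t2 : a₀ * Φ * (s₁ * γ₀ * u₁) * (Φ + m) ≤ a₀ * Φ * u₀ * (Φ + m) := by
    have h := mul_le_mul_of_nonneg_left hu₀ (le_of_lt (mul_pos ha₀ hΦ))
    exact mul_le_mul_of_nonneg_right h (le_of_lt hΦm)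
  have t3 : a₀ * Φ * (s₁ * γ₀ * u₁) * (Φ + m) - a₀ * m * (a₀ * Φ * s₁ * u₁ - N') - γ₀ * N' * (Φ + m)
      = (a₀ * Φ * s₁ * u₁ - N') * (γ₀ * (Φ + m) - a₀ * m) := by ring
  have t4 : 0 ≤ (a₀ * Φ * s₁ * u₁ - N') * (γ₀ * (Φ + m) - a₀ * m) := mul_nonneg (by linarith) hκ'
  have hA : γ₀ * N' * (Φ + m) ≤ a₀ * ϖ * (Φ + m) := by linarith
  have hB : γ₀ * N' ≤ a₀ * ϖ := le_of_mul_le_mul_right hA hΦm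
  -- Step C: c Φ ≥ s₁ v₁ γ₀ N'
  have c1 : s₁ * a₀ * v₁ * ϖ ≤ D * ϖ := mul_le_mul_of_nonneg_right hD hϖ0
  have c2 : s₁ * v₁ * (γ₀ * N') ≤ s₁ * v₁ * (a₀ * ϖ) := mul_le_mul_of_nonneg_left hB (mul_nonneg (le_of_lt hs₁) hv₁)
  have c2' : s₁ * v₁ * (a₀ * ϖ) = s₁ * a₀ * v₁ * ϖ := by ring
  have c3 : s₁ * v₁ * (γ₀ * N') ≤ c * Φ := by rw [hc]; linarith
  -- Step D/E
  set W := v₁ * γ₀ * a₀ * N' with hWdef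
  have hW : 0 ≤ W := mul_nonneg (mul_nonneg (mul_nonneg hv₁ (le_of_lt hγ₀)) (le_of_lt ha₀)) hN'0
  have d0 : g₀ * (a₀ * p₀) ≤ (1 - s₁) * W := by rw [hg₀]; exact mul_le_mul_of_nonneg_left hUt (by linarith)
  have d1 : ex * (g₀ * (a₀ * p₀)) * Φ ≤ ex * ((1 - s₁) * W) * Φ :=
    mul_le_mul_of_nonneg_right (mul_le_mul_of_nonneg_left d0 hex) (le_of_lt hΦ)
  have d2 : ex * ((1 - s₁) * W) * Φ = ((1 - s₁) * ex * Φ) * W := by ring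
  have d3 : ((1 - s₁) * ex * Φ) * W ≤ (s₁ * p₀) * W := mul_le_mul_of_nonneg_right hJ hW
  have d4 : (s₁ * p₀) * W = (a₀ * p₀) * (s₁ * v₁ * (γ₀ * N')) := by rw [hWdef]; ring
  have d5 : (a₀ * p₀) * (s₁ * v₁ * (γ₀ * N')) ≤ (a₀ * p₀) * (c * Φ) :=
    mul_le_mul_of_nonneg_left c3 (le_of_lt (mul_pos ha₀ hp₀))
  have d6 : ex * g₀ * (a₀ * p₀ * Φ) ≤ c * (a₀ * p₀ * Φ) := by
    have e : ex * g₀ * (a₀ * p₀ * Φ) = ex * (g₀ * (a₀ * p₀)) * Φ := by ring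
    have e' : c * (a₀ * p₀ * Φ) = (a₀ * p₀) * (c * Φ) := by ring
    rw [e, e']; linarith
  exact le_of_mul_le_mul_right d6 (by positivity)

/-- **LEMMA KV (kill-or-visibility), algebraic core, every depth.**  With `Ũ = u″L̃ + v″R̃ − Γu″v″`, `L̃ ≥ 0`, `u″, v″, m″ ≥ 0`,
LEMMA R~ in the Chebyshev form `R̃·m″ ≥ γ(Φ+m)u″v″` and `Γ = γa²ΦS`:
`Ũ·m″ ≥ γ·u″v″·[(Φ+m)v″ − a²ΦS·m″]` — either the far C-channel is shallow (`v″ ≤ a²ΦS m″/(Φ+m)`) or the depth kills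
quadratically.  [cite: KozmaNitzan2024, Question 8 (§5.5 p. 36)] -/
theorem kill_or_visibility_core (Ut u v L R Γ γ a Φ S m PM : ℝ) (hUt : Ut = u * L + v * R - Γ * u * v)
    (hL : 0 ≤ L) (hu : 0 ≤ u) (hv : 0 ≤ v) (hm : 0 ≤ m) (hR : γ * PM * u * v ≤ R * m) (hΓ : Γ = γ * a ^ 2 * Φ * S) :
    γ * u * v * (PM * v - a ^ 2 * Φ * S * m) ≤ Ut * m := by
  rw [hUt, hΓ]
  nlinarith [mul_nonneg (mul_nonneg hu hL) hm, mul_le_mul_of_nonneg_left hR hv]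

/-- **THEOREM NX′ at k = 1, per-class bound.**  For a class of `T₁` with `0 ≤ p ≤ 1`, `α ≤ 1`, `0 ≤ κ ≤ C₁`, `λ ≥ 0`, the
(VIS+)-summand `f = λpκ(1−α) − (1−p) − p(1−α)(1−κ)` is at most `p(1−α)((1+λ)C₁ − 1)`.
[cite: KozmaNitzan2024, Question 8 (§5.5 p. 36)] -/
theorem nx_class_bound (lam p α κ C₁ : ℝ) (hlam : 0 ≤ lam) (hp0 : 0 ≤ p) (hp1 : p ≤ 1) (hα : α ≤ 1) (hκ : κ ≤ C₁) :
    lam * p * κ * (1 - α) - (1 - p) - p * (1 - α) * (1 - κ) ≤ p * (1 - α) * ((1 + lam) * C₁ - 1) := by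
  have h1 : 0 ≤ p * (1 - α) := mul_nonneg hp0 (by linarith)
  have h2 : (1 + lam) * κ ≤ (1 + lam) * C₁ := mul_le_mul_of_nonneg_left hκ (by linarith)
  have h3 : p * (1 - α) * ((1 + lam) * κ) ≤ p * (1 - α) * ((1 + lam) * C₁) := mul_le_mul_of_nonneg_left h2 h1
  have e : lam * p * κ * (1 - α) - (1 - p) - p * (1 - α) * (1 - κ) = p * (1 - α) * ((1 + lam) * κ) - p * (1 - α) - (1 - p) := by ring
  have e' : p * (1 - α) * ((1 + lam) * C₁ - 1) = p * (1 - α) * ((1 + lam) * C₁) - p * (1 - α) := by ring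
  rw [e, e']; linarith

open Finset in
/-- **THEOREM NX′ at k = 1, conclusion.**  If `Σ_l r_l f_l > 0` (positivity at depth 0 in the form (VIS+)) and every summand is
bounded by `w_l·K` with `w_l ≥ 0`, then `K > 0`; with `nx_class_bound` (`w_l = r_lp_l(1−α_l)`, `K = (1+λ)C₁ − 1`) this is
`(1−C₁)/C₁ < λ = a₀Φs₁/(Φ+m)` (sharp).  [cite: KozmaNitzan2024, Question 8 (§5.5 p. 36)] -/
theorem pos_of_weighted_sum_pos {ι : Type*} (L : Finset ι) (rf w : ι → ℝ) (K : ℝ)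
    (hle : ∀ l ∈ L, rf l ≤ w l * K) (hw : ∀ l ∈ L, 0 ≤ w l) (hpos : 0 < ∑ l ∈ L, rf l) : 0 < K := by
  by_contra hK
  rw [not_lt] at hK
  have h1 : ∑ l ∈ L, rf l ≤ ∑ l ∈ L, w l * K := sum_le_sum hle
  have h2 : ∑ l ∈ L, w l * K ≤ 0 :=
    sum_nonpos (fun l hl => mul_nonpos_of_nonneg_of_nonpos (hw l hl) hK)
  linarith

/-- **NX′ ⟹ LEMMA J (k₁ = 1), the final bound.**  With `0 ≤ s₁ ≤ 1`, `0 ≤ a₀ ≤ 1`, `0 < Φ ≤ p₀`, `m ≥ 0` and the positive-region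
corollary `1 − γ₀ ≤ a₀²s₁/3` (gen 27, REMARK (iv) at depth 0): `(1−s₁)a₀²Φ² ≤ γ₀(Φ+m)p₀`, i.e. `ρ₀θ₀λ ≤ p₀/Φ` for
`λ = a₀Φs₁/(Φ+m)`, `θ₀ = a₀/γ₀`, `ρ₀ = (1−s₁)/s₁`.  [cite: KozmaNitzan2024, Question 8 (§5.5 p. 36)] -/
theorem lemmaJ_of_nx_bound (s₁ a₀ γ₀ Φ m p₀ : ℝ) (hs0 : 0 ≤ s₁) (hs1 : s₁ ≤ 1) (ha0 : 0 ≤ a₀) (ha1 : a₀ ≤ 1)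
    (hΦ : 0 < Φ) (hp : Φ ≤ p₀) (hm : 0 ≤ m) (hγ : 1 - γ₀ ≤ a₀ ^ 2 * s₁ / 3) :
    (1 - s₁) * a₀ ^ 2 * Φ ^ 2 ≤ γ₀ * (Φ + m) * p₀ := by
  have ha2 : a₀ ^ 2 ≤ 1 := by nlinarith
  have hγ0 : 1 - a₀ ^ 2 * s₁ / 3 ≤ γ₀ := by linarith
  have hc : (1 - s₁) * a₀ ^ 2 ≤ 1 - a₀ ^ 2 * s₁ / 3 := by nlinarith [mul_nonneg (sq_nonneg a₀) hs0]
  have h1 : (1 - s₁) * a₀ ^ 2 * Φ ^ 2 ≤ (1 - a₀ ^ 2 * s₁ / 3) * Φ ^ 2 := by nlinarith [sq_nonneg Φ]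
  have h2 : (1 - a₀ ^ 2 * s₁ / 3) * Φ ^ 2 ≤ γ₀ * Φ ^ 2 := by nlinarith [sq_nonneg Φ]
  have h3 : γ₀ * Φ ^ 2 ≤ γ₀ * (Φ + m) * p₀ := by
    have hγpos : 0 ≤ γ₀ := by nlinarith [mul_nonneg (sq_nonneg a₀) hs0]
    have : Φ ^ 2 ≤ (Φ + m) * p₀ := by nlinarith [mul_nonneg hm (le_of_lt hΦ)]
    nlinarith [mul_le_mul_of_nonneg_left this hγpos]
  linarith

/-- **(VIS+) at a positive depth, algebraic core.**  Positivity `Ũ_i < 0` with `L̃_i ≥ 0`, `u″, v″ ≥ 0` forces `R̃_i < Γ_iu″`; with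
`R̃_i ≥ γ_ia_iK₄`, `K₄ = (Φ+m)(1−Φ) ≥ (Φ+m)(1−p_i)` (`Φ ≤ p_i`) and `Γ_i = γ_ia_i²ΦS_{i+1}`, `γ_i, a_i > 0`:
`(Φ+m)(1−p_i) < a_iΦS_{i+1}u″`.  [cite: KozmaNitzan2024, Question 8 (§5.5 p. 36)] -/
theorem visibility_plus_core (Ut u v L R Γ γ a Φ S m p : ℝ) (hUt : Ut = u * L + v * R - Γ * u * v) (hneg : Ut < 0)
    (hL : 0 ≤ L) (hu : 0 ≤ u) (hv : 0 ≤ v) (hγ : 0 < γ) (ha : 0 < a) (hm : 0 ≤ m) (hΦp : Φ ≤ p) (hΦ : 0 ≤ Φ)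
    (hR : γ * a * ((Φ + m) * (1 - Φ)) ≤ R) (hΓ : Γ = γ * a ^ 2 * Φ * S) :
    (Φ + m) * (1 - p) < a * Φ * S * u := by
  have huL : 0 ≤ u * L := mul_nonneg hu hL
  have h1 : v * R - Γ * u * v < 0 := by rw [hUt] at hneg; linarith
  have e0 : v * (R - Γ * u) = v * R - Γ * u * v := by ring
  have h1' : v * (R - Γ * u) < 0 := by rw [e0]; exact h1
  have h2 : R - Γ * u < 0 := by
    by_contra hc
    rw [not_lt] at hc
    have : 0 ≤ v * (R - Γ * u) := mul_nonneg hv hc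
    linarith
  have h3 : γ * a * ((Φ + m) * (1 - Φ)) < γ * a * (a * Φ * S * u) := by
    have e : Γ * u = γ * a * (a * Φ * S * u) := by rw [hΓ]; ring
    linarith [e ▸ h2]
  have h4 : (Φ + m) * (1 - Φ) < a * Φ * S * u := lt_of_mul_lt_mul_left h3 (le_of_lt (mul_pos hγ ha))
  have hΦm : 0 ≤ Φ + m := by linarith
  have h5 : (Φ + m) * (1 - p) ≤ (Φ + m) * (1 - Φ) := mul_le_mul_of_nonneg_left (by linarith) hΦm
  linarith

/-- **THEOREM (★1′) — per-class bound for a BLIND class (gen 29, second file part).**  For a class `l < k` of `T₁` (ending before the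
hypothesis depth) with `0 ≤ p ≤ 1`, `α ≤ 1`, `0 < κ`, `λ' ≥ 0` (`λ' = a₀λ`): the (VIS+)-summand
`f′ = λ'pκ(1−α) − (1−p) − p(1−α)(1−κ)` is at most `p(1−α)·max(0, λ'κ − (1−κ))` — a blind class supports positivity at depth 0 only
through its A-defect mass `pκ(1−α)` and only if its C-prefix is clean (`(1−κ)/κ < λ'`).
[cite: KozmaNitzan2024, Question 8 (§5.5 p. 36)] -/
theorem nx_blind_class_bound (lam' p α κ : ℝ) (hp0 : 0 ≤ p) (hp1 : p ≤ 1) (hα : α ≤ 1) :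
    lam' * p * κ * (1 - α) - (1 - p) - p * (1 - α) * (1 - κ) ≤ p * (1 - α) * max 0 (lam' * κ - (1 - κ)) := by
  have h1 : 0 ≤ p * (1 - α) := mul_nonneg hp0 (by linarith)
  have e : lam' * p * κ * (1 - α) - (1 - p) - p * (1 - α) * (1 - κ) = p * (1 - α) * (lam' * κ - (1 - κ)) - (1 - p) := by ring
  rw [e]
  have h2 : p * (1 - α) * (lam' * κ - (1 - κ)) ≤ p * (1 - α) * max 0 (lam' * κ - (1 - κ)) :=
    mul_le_mul_of_nonneg_left (le_max_right _ _) h1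
  linarith

/-- **THEOREM (★1′) — the blind bound for the positive emission, algebraic core (k₁ = 1).**  If the positive depth 0 has
`|Ũ₀| ≤ v₁γ₀(a₀²Φs₁u₁ − K₄)` (`L̃₀ ≥ 0`, `R₀ ≥ K₄`), `K₄ ≥ (Φ+m)(1−p₀)`, and the class decomposition of `T₁` gives
`a₀²Φs₁u₁ − (Φ+m)(1−p₀) = (Φ+m)·SL` with `SL ≤ a₀λ·Ubl − CX·ν` (sum of `nx_class_bound` over the classes `l ≥ k` and of
`nx_blind_class_bound` over the blind classes; `Ubl` = clean blind A-defect mass, `CX·ν ≥ 0` the excess term of the classes `≥ k` when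
`X ≥ 0`), `λ(Φ+m) = a₀Φs₁`, then `g₀·(a₀p₀) = (1−s₁)|Ũ₀| ≤ (1−s₁)·v₁γ₀a₀²Φs₁·Ubl`: when the C-defect of `[1,k]` exceeds the visibility
allowance, the positive emission is carried by the BLIND A-defect mass only (and vanishes with it: NX′ holds whenever no A-defect precedes k).
[cite: KozmaNitzan2024, Question 8 (§5.5 p. 36)] -/
theorem g0_blind_core (Ut v₁ γ₀ a₀ Φ s₁ u₁ K₄ m p₀ SL lam Ubl CXν g₀ : ℝ)
    (hUt : Ut ≤ v₁ * γ₀ * (a₀ ^ 2 * Φ * s₁ * u₁ - K₄)) (hK₄ : (Φ + m) * (1 - p₀) ≤ K₄)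
    (hSL : a₀ ^ 2 * Φ * s₁ * u₁ - (Φ + m) * (1 - p₀) = (Φ + m) * SL) (hSLle : SL ≤ a₀ * lam * Ubl - CXν) (hCX : 0 ≤ CXν)
    (hlam : lam * (Φ + m) = a₀ * Φ * s₁) (hv : 0 ≤ v₁) (hγ : 0 ≤ γ₀) (hΦm : 0 ≤ Φ + m) (hs : s₁ ≤ 1)
    (hg₀ : g₀ * (a₀ * p₀) = (1 - s₁) * Ut) :
    g₀ * (a₀ * p₀) ≤ (1 - s₁) * (v₁ * γ₀ * (a₀ ^ 2 * Φ * s₁) * Ubl) := by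
  have h1 : a₀ ^ 2 * Φ * s₁ * u₁ - K₄ ≤ (Φ + m) * SL := by linarith
  have h2 : (Φ + m) * SL ≤ (Φ + m) * (a₀ * lam * Ubl) := by
    have : SL ≤ a₀ * lam * Ubl := by linarith
    exact mul_le_mul_of_nonneg_left this hΦm
  have h3 : (Φ + m) * (a₀ * lam * Ubl) = a₀ ^ 2 * Φ * s₁ * Ubl := by
    have : (Φ + m) * (a₀ * lam * Ubl) = a₀ * (lam * (Φ + m)) * Ubl := by ring
    rw [this, hlam]; ring
  have h4 : Ut ≤ v₁ * γ₀ * (a₀ ^ 2 * Φ * s₁ * Ubl) := by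
    have hvγ : 0 ≤ v₁ * γ₀ := mul_nonneg hv hγ
    calc Ut ≤ v₁ * γ₀ * (a₀ ^ 2 * Φ * s₁ * u₁ - K₄) := hUt
      _ ≤ v₁ * γ₀ * (a₀ ^ 2 * Φ * s₁ * Ubl) := mul_le_mul_of_nonneg_left (by linarith) hvγ
  rw [hg₀]
  have : (1 - s₁) * Ut ≤ (1 - s₁) * (v₁ * γ₀ * (a₀ ^ 2 * Φ * s₁ * Ubl)) := mul_le_mul_of_nonneg_left h4 (by linarith)
  linarith

/-- **k = 2, step (P2): the far C-channel through e₂ is O(ŵ).**  With `v₁ = A₁(1−C₁)m̃ + s₂A₁v₂` (exact split of the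
depth-0 C-channel), positivity at depth 0 in the form `v₁ < L·A₁C₁m̃` (`L = a₀λ`), and `1 − C₁ = δ₁C₁`:
`s₂A₁v₂ < A₁C₁m̃(L − δ₁)` — the part of the C-channel seen through the edge e₂ is bounded by the visibility slack `L − δ₁ = a₀λŵ`.
[cite: KozmaNitzan2024, Question 8 (§5.5 p. 36)] -/
theorem k2_far_channel_core (v₁ v₂ A₁ C₁ mt s₂ L δ₁ : ℝ) (hv : v₁ = A₁ * (1 - C₁) * mt + s₂ * A₁ * v₂)
    (hpos : v₁ < L * A₁ * C₁ * mt) (hδ : 1 - C₁ = δ₁ * C₁) :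
    s₂ * A₁ * v₂ < A₁ * C₁ * mt * (L - δ₁) := by
  have e : A₁ * (1 - C₁) * mt = δ₁ * (A₁ * C₁ * mt) := by rw [hδ]; ring
  nlinarith [e]

/-- **k = 2, step (P5): the K₄-margin at depth 1 under the excess condition.**  If `K₄ ≥ PM·u₂(δ₂ + s₂(1−C₁))`
(`PM = Φ+m`; joint and far defects of `T₁` seen through `C₂` and `C₁C₂`), the excess condition `δ₂ ≥ C₁(lam − δ₁)` (`X₂ > 0`),
`δ₁ ≤ lam(1 − w)` (`w = ŵ₁`, `a₀ ≤ 1`), `1 − C₁ = δ₁C₁`, `s₂ ≤ 1`, and `G = PM·lam·A₁·s₂` (`= a₁ΦS₂`), then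
`K₄ − G·u₂ ≥ PM·lam·u₂·(C₁w(1−s₂) − s₂(A₁−C₁))`.  [cite: KozmaNitzan2024, Question 8 (§5.5 p. 36)] -/
theorem k2_K4_margin_core (K₄ PM u₂ δ₁ δ₂ s₂ C₁ A₁ lam w G : ℝ) (hPM : 0 ≤ PM) (hu : 0 ≤ u₂) (hs1 : s₂ ≤ 1)
    (hC : 0 ≤ C₁)
    (hK : PM * u₂ * (δ₂ + s₂ * (1 - C₁)) ≤ K₄) (hX : C₁ * (lam - δ₁) ≤ δ₂) (hw : δ₁ ≤ lam * (1 - w)) (hδC : 1 - C₁ = δ₁ * C₁)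
    (hG : G = PM * lam * A₁ * s₂) :
    PM * lam * u₂ * (C₁ * w * (1 - s₂) - s₂ * (A₁ - C₁)) ≤ K₄ - G * u₂ := by
  have hPu : 0 ≤ PM * u₂ := mul_nonneg hPM hu
  -- δ₂ + s₂(1−C₁) ≥ C₁(lam−δ₁) + s₂δ₁C₁ = C₁(lam − δ₁(1−s₂)) ≥ C₁(lam − lam(1−w)(1−s₂))
  have h1 : C₁ * (lam - δ₁ * (1 - s₂)) ≤ δ₂ + s₂ * (1 - C₁) := by rw [hδC]; nlinarith
  have h2 : C₁ * (lam - lam * (1 - w) * (1 - s₂)) ≤ C₁ * (lam - δ₁ * (1 - s₂)) := by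
    apply mul_le_mul_of_nonneg_left _ hC
    nlinarith [mul_le_mul_of_nonneg_right hw (by linarith : (0:ℝ) ≤ 1 - s₂)]
  have h3 : PM * u₂ * (C₁ * (lam - lam * (1 - w) * (1 - s₂))) ≤ K₄ := by
    calc PM * u₂ * (C₁ * (lam - lam * (1 - w) * (1 - s₂))) ≤ PM * u₂ * (δ₂ + s₂ * (1 - C₁)) :=
          mul_le_mul_of_nonneg_left (le_trans h2 h1) hPu
      _ ≤ K₄ := hK
  have e : PM * lam * u₂ * (C₁ * w * (1 - s₂) - s₂ * (A₁ - C₁)) + G * u₂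
      = PM * u₂ * (C₁ * (lam - lam * (1 - w) * (1 - s₂))) := by rw [hG]; ring
  linarith [e]

/-- **k = 2, step (P6): the L-kill dominates the Γ-deficit.**  Multiplicative core: if `NEGP ≤ L·q` with the explicit ratio
`q = 4s₁a₀²C₁w/((3+s₁)A₁)` (from (P2), `m ≥ s₁a₀γ₀A₁C₁m̃`, `(A₁−C₁)⁺ ≤ δ₁C₁`) and `0 < A₁`, `C₁ ≤ A₁` (the only case with `NEGP > 0`),
`0 ≤ a₀ ≤ 1`, `0 ≤ w ≤ 1`, `0 ≤ s₁ ≤ 1`, `L ≥ 0`, then `NEGP ≤ L`.  [cite: KozmaNitzan2024, Question 8 (§5.5 p. 36)] -/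
theorem k2_L_dominates_core (NEGP L s₁ a₀ C₁ A₁ w : ℝ) (hL : 0 ≤ L) (hA : 0 < A₁) (hCA : C₁ ≤ A₁) (hC : 0 ≤ C₁)
    (ha0 : 0 ≤ a₀) (ha1 : a₀ ≤ 1) (hw0 : 0 ≤ w) (hw1 : w ≤ 1) (hs0 : 0 ≤ s₁) (hs1 : s₁ ≤ 1)
    (hN : NEGP * ((3 + s₁) * A₁) ≤ L * (4 * s₁ * a₀ ^ 2 * C₁ * w)) : NEGP ≤ L := by
  have hq : 4 * s₁ * a₀ ^ 2 * C₁ * w ≤ (3 + s₁) * A₁ := by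
    have h1 : a₀ ^ 2 ≤ 1 := by nlinarith
    have h2 : 4 * s₁ * a₀ ^ 2 * C₁ * w ≤ 4 * s₁ * C₁ := by
      have : a₀ ^ 2 * w ≤ 1 := by nlinarith [mul_le_mul h1 hw1 hw0 (by norm_num : (0:ℝ) ≤ 1)]
      nlinarith [mul_nonneg (mul_nonneg (by norm_num : (0:ℝ) ≤ 4) hs0) hC]
    nlinarith [mul_le_mul_of_nonneg_left hCA (by nlinarith : (0:ℝ) ≤ 4 * s₁)]
  have hpos : 0 < (3 + s₁) * A₁ := by positivity
  have : NEGP * ((3 + s₁) * A₁) ≤ L * ((3 + s₁) * A₁) := le_trans hN (mul_le_mul_of_nonneg_left hq hL)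
  exact le_of_mul_le_mul_right this hpos

/-- **k = 2, step (P8): the depth-0 far factor is at least one half.**  From positivity at depth 0 in the form `1 − Φ < s₁p₀`
(`1−Φ < a₀Φs₁u₁/(Φ+m) ≤ s₁u₁ ≤ s₁p₀`) and `Φ ≤ p₀`, `0 ≤ s₁`:  `p₀(1+s₁) > 1`.  [cite: KozmaNitzan2024, Question 8 (§5.5 p. 36)] -/
theorem k2_p0_lower_core (Φ p₀ s₁ : ℝ) (h1 : 1 - Φ < s₁ * p₀) (h2 : Φ ≤ p₀) : 1 < p₀ * (1 + s₁) := by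
  nlinarith

end PocketCert

end Summit.CriticalPhenomena.PercolationContinuityZ3.Theorems
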